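import Mathlib
import Literature.Computability.AlgebraicComplexity.DeterminantalComplexity
import Summits.ValiantsHypothesis.ValiantsHypothesis.Theorems.PrincipalMinorColouringNormalForm
import Summits.ValiantsHypothesis.ValiantsHypothesis.Theorems.ContractivityPricePriceOfContractivityStubBalancedBudgetInjective
import Summits.ValiantsHypothesis.ValiantsHypothesis.Theorems.ContractivityPricePriceOfContractivityStubStableLiftingTwoColour
import Summits.ValiantsHypothesis.ValiantsHypothesis.Theorems.ContractivityPricePriceOfContractivityStubNormHalvingRescale
import Summits.ValiantsHypothesis.ValiantsHypothesis.Theorems.ContractivityPricePriceOfContractivityStubFewColours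
import HarnessLib

/-!
# Crux `PriceOfContractivity` (stmt-ValiantsHypothesis-10583), line `registered` (birth rev 13) —
# stub `stub_priceOfContractivity_fewVars` (the crux for `N ≤ 2 log₂(m+N) + 3` variables, from NH₁)

Route `ValiantsHypothesis/ContractivityPrice`, crux K1 (`…Theses.ContractivityPrice.PriceOfContractivity`):
a polynomial `p` over `ℂ` in `≤ N` variables with an affine determinantal representation of size `m`
and no zero on the CLOSED polydisc of radius `2` has a contractive Sylvester realization
`p = p(0) · det (1 + diag (X ∘ κ) · K)`, `‖K‖_op ≤ 1`, of size `R ≤ 2 ^ ((log₂ (m + N) + d) ^ d)`.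
The lead's skeleton (line `birth`, rev 13) proves it from two stubs, the stable determinantal
lifting ♦ (open in general) and the norm-halving step NH₁ (open).  Theorem A″
(`FewColours.stub_stableLifting_fewColours`, landed) is ♦ for colourings with at most `L + 1`
colours, and the composition invokes ♦ ONCE, at `L = 2 log₂ (m + N) + 2`, on the colouring of the
Sylvester normal form of `p`, which uses `≤ #σ ≤ N` colours.  Hence NH₁ ALONE gives the crux for
`N ≤ 2 log₂ (m + N) + 3 = L + 1`: the registered stub `stub_priceOfContractivity_fewVars` (NH₁
verbatim as its first hypothesis), proved here by re-running the skeleton's composition —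
Sylvester normal form (§2), balanced budget from Theorem A″ + the landed cycle-mean bound +
max-plus balancing (§1), NH₁ rescaled to every norm scale (the landed
`NormHalvingRescale.stub_normHalvingRescale`) and iterated along the bit budget (§3), size and
domain arithmetic (§3).  No definitions; pure theorem file.  Every lemma except the stub is copied
(§1–§2: adapted) from the lead's checked skeleton `Cruxes/PriceOfContractivity/Lines/birth.lean`
(rev 13, §2c–§5); the stub adapts its §6.  The five pieces of the cycle-mean bound
(`…Stub{ArcStep,PermCounts,ArcInduction,CycleBalancing,CycleBound}`) are imported through
`…StubBalancedBudgetInjective`.  References: folklore (Sylvester pencils, diagonal similarity,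
Leibniz degree bound, bit-budget induction).
-/

noncomputable section

-- `Summit.<Summit>.<Problem>` repeats `ValiantsHypothesis` by the tree's layout convention (D-0017).
set_option linter.dupNamespace false

namespace Summit.ValiantsHypothesis.ValiantsHypothesis.Theorems.PriceOfContractivity.FewVars

open MvPolynomial Matrix
open Literature.Computability.AlgebraicComplexity
open Summit.ValiantsHypothesis.Theorems.PrincipalMinorColouring
  (det_add_linearPart_eq map_constantCoeff_shift)
open Summit.ValiantsHypothesis.ValiantsHypothesis.Theorems.PriceOfContractivity
open Summit.ValiantsHypothesis.ValiantsHypothesis.Theorems.PriceOfContractivity.BalancedBudgetInjective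
  (norm_toEuclideanCLM_le_of_entry_le det_pencil_diagConj)

/-! ### §1 The balanced budget from Theorem A″, the cycle-mean bound and balancing -/

/-- **Theorem 4 (cycle-mean bound)**, assembled from its landed pieces (modus ponens): if all
principal minors of `K` satisfy `|det K[w]| ≤ ν^{k+1}` then every cycle product satisfies
`|∏ K (v t) (v (t+1))| ≤ (240 R³ ν)^{n+1}`. [folklore]
(Copied from the skeleton, §2c; the statement `Sig.cycleBound` is inlined.) -/
theorem cycleBound_holds :
    ∀ (R : ℕ) (K : Matrix (Fin R) (Fin R) ℂ) (ν : ℝ), 0 ≤ ν →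
      (∀ (k : ℕ) (w : Fin (k + 1) → Fin R), Function.Injective w →
        ‖(K.submatrix w w).det‖ ≤ ν ^ (k + 1)) →
      ∀ (n : ℕ) (v : Fin (n + 1) → Fin R), Function.Injective v →
        ‖∏ t : Fin (n + 1), K (v t) (v (t + 1))‖ ≤ (240 * (R : ℝ) ^ 3 * ν) ^ (n + 1) :=
  CycleBound.stub_cycleBound CycleBalancing.stub_cycleBalancing
    (ArcInduction.stub_arcInduction ArcStep.stub_arcStep PermCounts.stub_permCounts)

/-- The exponent arithmetic of the budget glue: with `B = (L+d)^d`, `R₁ ≤ 2^B`, the final norm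
bound `R₁² · (240 R₁³ 2^B + 1)` is at most `2 ^ ((L + (d+6))^(d+6))`. (Copied from the skeleton, §2c.) -/
theorem exponent_bound₃ (d L R₁ : ℕ) (hR : R₁ ≤ 2 ^ ((L + d) ^ d)) :
    R₁ ^ 2 * (240 * R₁ ^ 3 * 2 ^ ((L + d) ^ d) + 1) ≤ 2 ^ ((L + (d + 6)) ^ (d + 6)) := by
  generalize hB : (L + d) ^ d = B at *
  have h1 : R₁ ^ 2 * (240 * R₁ ^ 3 * 2 ^ B + 1) ≤ 2 ^ (6 * B + 8) := by
    have hR2 : R₁ ^ 2 ≤ 2 ^ (2 * B) := by rw [pow_mul']; exact Nat.pow_le_pow_left hR 2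
    have hR3 : R₁ ^ 3 ≤ 2 ^ (3 * B) := by rw [pow_mul']; exact Nat.pow_le_pow_left hR 3
    have h240 : 240 * R₁ ^ 3 * 2 ^ B + 1 ≤ 2 ^ (4 * B + 8) := by
      have hone : 1 ≤ 2 ^ (4 * B) := Nat.one_le_two_pow
      calc 240 * R₁ ^ 3 * 2 ^ B + 1 ≤ 240 * 2 ^ (3 * B) * 2 ^ B + 2 ^ (4 * B) := by
            have := Nat.mul_le_mul_right (2 ^ B) (Nat.mul_le_mul_left 240 hR3); omega
        _ = 241 * 2 ^ (4 * B) := by ring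
        _ ≤ 2 ^ 8 * 2 ^ (4 * B) := Nat.mul_le_mul_right _ (by norm_num)
        _ = 2 ^ (4 * B + 8) := by rw [← pow_add]; ring_nf
    calc R₁ ^ 2 * (240 * R₁ ^ 3 * 2 ^ B + 1) ≤ 2 ^ (2 * B) * 2 ^ (4 * B + 8) :=
          Nat.mul_le_mul hR2 h240
      _ = 2 ^ (6 * B + 8) := by rw [← pow_add]; ring_nf
  refine h1.trans (Nat.pow_le_pow_right two_pos ?_)
  -- `6 B + 8 ≤ (L + d + 6)^(d + 6)` from `B ≤ (L+d+6)^d` and `6^6 ≥ 14`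
  have hB' : B ≤ (L + (d + 6)) ^ d := by rw [← hB]; exact Nat.pow_le_pow_left (by omega) d
  have h66 : 46656 ≤ (L + (d + 6)) ^ 6 :=
    calc 46656 = 6 ^ 6 := by norm_num
      _ ≤ (L + (d + 6)) ^ 6 := Nat.pow_le_pow_left (by omega) 6
  have hX1 : 1 ≤ (L + (d + 6)) ^ d := Nat.one_le_pow d (L + (d + 6)) (by omega)
  calc 6 * B + 8 ≤ 46656 * (L + (d + 6)) ^ d := by omega
    _ ≤ (L + (d + 6)) ^ 6 * (L + (d + 6)) ^ d := Nat.mul_le_mul_right _ h66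
    _ = (L + (d + 6)) ^ (d + 6) := by rw [← pow_add, add_comm 6 d]

/-- **The balanced budget for at most `L + 1` colours**, from Theorem A″, the cycle-mean bound and
balancing: the lifted `K₁` (all principal minors `≤ B₁^{size}`, `B₁ = 2^((L+d)^d)`) has cycle
products `≤ (240 R₁³ B₁)^{length}` (Theorem 4), a positive diagonal `D` makes every entry of
`D K₁ D⁻¹` at most `240 R₁³ B₁ + 1`, the pencil determinant is unchanged and the operator norm is
`≤ R₁² (240 R₁³ B₁ + 1) ≤ 2^((L+d+6)^(d+6))`. [folklore] (The skeleton's `balancedBudget_of`, §2c,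
with the LANDED Theorem A″ `FewColours.stub_stableLifting_fewColours` as the lifting input.) -/
theorem balancedBudget_fewColours :
    ∃ d : ℕ, ∀ (L R : ℕ) {σ : Type} (K₀ : Matrix (Fin R) (Fin R) ℂ) (κ : Fin R → σ),
      (∃ s : Finset σ, s.card ≤ L + 1 ∧ ∀ i, κ i ∈ s) →
      R ≤ 2 ^ L →
      (∀ z : σ → ℂ, (∀ j, ‖z j‖ ≤ 2) → MvPolynomial.eval z (1 + Matrix.diagonal (fun i => MvPolynomial.X (κ i)) * K₀.map (fun a : ℂ => (MvPolynomial.C a : MvPolynomial σ ℂ))).det ≠ 0) →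
      ∃ R₁ ≤ 2 ^ ((L + d) ^ d), ∃ (K₁ : Matrix (Fin R₁) (Fin R₁) ℂ) (κ₁ : Fin R₁ → σ),
        ‖Matrix.toEuclideanCLM (𝕜 := ℂ) K₁‖ ≤ (2 : ℝ) ^ ((L + d) ^ d) ∧
        (1 + Matrix.diagonal (fun i => MvPolynomial.X (κ i)) * K₀.map (fun a : ℂ => (MvPolynomial.C a : MvPolynomial σ ℂ))).det =
          (1 + Matrix.diagonal (fun i => MvPolynomial.X (κ₁ i)) * K₁.map (fun a : ℂ => (MvPolynomial.C a : MvPolynomial σ ℂ))).det := by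
  obtain ⟨d, hd⟩ := FewColours.stub_stableLifting_fewColours
  refine ⟨d + 6, fun L R σ K₀ κ hcol hR hz => ?_⟩
  obtain ⟨R₁, hR₁, K₁, κ₁, hmin, hdet⟩ := hd L R K₀ κ hcol hR hz
  -- Theorem 4: cycle products of `K₁`
  set B₁ : ℝ := (2 : ℝ) ^ ((L + d) ^ d) with hB₁
  have hB₁0 : 0 ≤ B₁ := by positivity
  have hcycK := cycleBound_holds R₁ K₁ B₁ hB₁0 hmin
  -- balancing at level `M = 240 R₁³ B₁ + 1 > 0`
  set M : ℝ := 240 * (R₁ : ℝ) ^ 3 * B₁ + 1 with hM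
  have hM0 : 0 < M := by positivity
  have hcycM : ∀ (n : ℕ) (v : Fin (n + 1) → Fin R₁), Function.Injective v →
      ‖∏ t : Fin (n + 1), K₁ (v t) (v (t + 1))‖ ≤ M ^ (n + 1) := by
    intro n v hv
    refine (hcycK n v hv).trans (pow_le_pow_left₀ (by positivity) ?_ _)
    rw [hM]; linarith
  obtain ⟨dd, hdd0, hdd⟩ := CycleBalancing.stub_cycleBalancing R₁ K₁ M hM0 hcycM
  -- the balanced matrix
  set K₂ : Matrix (Fin R₁) (Fin R₁) ℂ :=
    Matrix.of fun i j => ((dd i : ℝ) : ℂ) * K₁ i j * (((dd j : ℝ) : ℂ))⁻¹ with hK₂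
  have hentry : ∀ i j, ‖K₂ i j‖ ≤ M := by
    intro i j
    rw [hK₂, Matrix.of_apply, norm_mul, norm_mul, norm_inv, Complex.norm_real, Complex.norm_real,
      Real.norm_of_nonneg (hdd0 i).le, Real.norm_of_nonneg (hdd0 j).le]
    have := hdd i j
    rwa [div_eq_mul_inv] at this
  have hnorm : ‖Matrix.toEuclideanCLM (𝕜 := ℂ) K₂‖ ≤ (R₁ : ℝ) ^ 2 * M :=
    norm_toEuclideanCLM_le_of_entry_le K₂ hM0.le hentry
  have hdet₂ := det_pencil_diagConj K₁ κ₁ (fun i => ((dd i : ℝ) : ℂ))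
    (fun i => Complex.ofReal_ne_zero.mpr (hdd0 i).ne')
  refine ⟨R₁, hR₁.trans (Nat.pow_le_pow_right two_pos ?_), K₂, κ₁, hnorm.trans ?_, ?_⟩
  · -- `(L+d)^d ≤ (L+d+6)^(d+6)`
    calc (L + d) ^ d ≤ (L + (d + 6)) ^ d := Nat.pow_le_pow_left (by omega) d
      _ ≤ (L + (d + 6)) ^ (d + 6) := Nat.pow_le_pow_right (by omega) (by omega)
  · -- the norm arithmetic, transported from `ℕ`
    have hnat := exponent_bound₃ d L R₁ hR₁
    have hcast : (R₁ : ℝ) ^ 2 * M = ((R₁ ^ 2 * (240 * R₁ ^ 3 * 2 ^ ((L + d) ^ d) + 1) : ℕ) : ℝ) := by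
      rw [hM, hB₁]; push_cast; ring
    rw [hcast]
    exact_mod_cast hnat
  · rw [hdet, ← hdet₂]

/-! ### §2 The Sylvester normal form of an affine determinantal representation -/

/-- **Sylvester normal form.** If `p` has an affine determinantal representation of size `m` and
`p(0) ≠ 0`, then `p = p(0) · det(1 + diag(x ∘ κ) · K)` for some `K ∈ ℂ^{R×R}`, `κ : [R] → σ`, with
`R ≤ #σ · m` (write `A = A(0) + Σ_e x_e A_e`, rank-factor the `A_e`, pull out `A(0)` and commute the
rectangular factors: the tree's `det_add_linearPart_eq`). [folklore]
(Adapted from the skeleton, §3: its defs `constPart`/`linPart` are the local matrices `A0`, `Ae`.) -/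
theorem normalForm_of_hasDetRepr {σ : Type} [Fintype σ] {m : ℕ} {p : MvPolynomial σ ℂ}
    (h : HasDetRepr p m) (hp : MvPolynomial.eval 0 p ≠ 0) :
    ∃ R ≤ Fintype.card σ * m, ∃ (K : Matrix (Fin R) (Fin R) ℂ) (κ : Fin R → σ),
      p = MvPolynomial.C (MvPolynomial.eval 0 p) *
        (1 + Matrix.diagonal (fun i => MvPolynomial.X (κ i)) * K.map (fun a : ℂ => (MvPolynomial.C a : MvPolynomial σ ℂ))).det := by
  classical
  obtain ⟨A, haff, hdet⟩ := h
  -- constant part `A(0)` and coefficient matrices `A_e` of the affine matrix `A`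
  obtain ⟨A0, hA0⟩ : ∃ A0 : Matrix (Fin m) (Fin m) ℂ, A0 = Matrix.of fun i j => coeff 0 (A i j) :=
    ⟨_, rfl⟩
  obtain ⟨Ae, hAe⟩ : ∃ Ae : σ → Matrix (Fin m) (Fin m) ℂ,
      Ae = fun e => Matrix.of fun i j => coeff (Finsupp.single e 1) (A i j) := ⟨_, rfl⟩
  -- `p = det (A(0) + Σ_e x_e A_e)`
  have e1 : p = (A0.map C + Matrix.of (fun i j => ∑ e, C (Ae e i j) * X e) :
      Matrix (Fin m) (Fin m) (MvPolynomial σ ℂ)).det := by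
    refine hdet.symm.trans (congrArg Matrix.det (Matrix.ext fun i j => ?_))
    subst hA0 hAe
    simp only [Matrix.add_apply, Matrix.map_apply, Matrix.of_apply]
    exact LRPencil.eq_affine_of_totalDegree_le_one (A i j) (haff i j)
  -- `p(0) = det A(0)`
  have e2 : MvPolynomial.eval 0 p = A0.det := by
    rw [MvPolynomial.eval_zero, e1, RingHom.map_det, RingHom.mapMatrix_apply]
    exact congrArg Matrix.det (map_constantCoeff_shift A0 Ae)
  have hunit : IsUnit A0.det := by rw [← e2]; exact isUnit_iff_ne_zero.mpr hp
  obtain ⟨R, hR, K, κ, hK⟩ := det_add_linearPart_eq A0 hunit Ae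
  refine ⟨R, hR.trans ?_, K, κ, by rw [e2]; exact e1.trans hK⟩
  calc ∑ e, (Ae e).rank ≤ ∑ _e : σ, m := Finset.sum_le_sum fun e _ => Matrix.rank_le_width (Ae e)
    _ = Fintype.card σ * m := by rw [Finset.sum_const, Finset.card_univ, smul_eq_mul]

/-! ### §3 Iterating the halving step; the size arithmetic -/

/-- **Price within a budget, on a domain.** If one halving costs a size factor `q ≥ 1` for inputs of
size `≤ Q` (the halving step at a fixed bound `n` on #variables and degree), then `b` halvings bring
a realization with `‖K‖ ≤ 2 ^ b` and `q ^ b · R ≤ Q` to a contractive one at size `≤ q ^ b · R`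
(induction on `b` with the invariant `q ^ b · R ≤ Q`). [folklore] (Copied from the skeleton, §4.) -/
theorem priceInBudget_of_normHalvingDom {q Q n : ℕ} (hq : 1 ≤ q)
    (hc : ∀ (R : ℕ) (M : ℝ) {σ : Type} [Fintype σ] (K : Matrix (Fin R) (Fin R) ℂ) (κ : Fin R → σ),
      R ≤ Q →
      Fintype.card σ ≤ n →
      (1 + Matrix.diagonal (fun i => MvPolynomial.X (κ i)) * K.map (fun a : ℂ => (MvPolynomial.C a : MvPolynomial σ ℂ))).det.totalDegree ≤ n →
      1 ≤ M →
      ‖Matrix.toEuclideanCLM (𝕜 := ℂ) K‖ ≤ 2 * M →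
      (∀ z : σ → ℂ, (∀ j, ‖z j‖ ≤ 2) → MvPolynomial.eval z (1 + Matrix.diagonal (fun i => MvPolynomial.X (κ i)) * K.map (fun a : ℂ => (MvPolynomial.C a : MvPolynomial σ ℂ))).det ≠ 0) →
      ∃ R' ≤ q * R, ∃ (K' : Matrix (Fin R') (Fin R') ℂ) (κ' : Fin R' → σ),
        ‖Matrix.toEuclideanCLM (𝕜 := ℂ) K'‖ ≤ M ∧
        (1 + Matrix.diagonal (fun i => MvPolynomial.X (κ i)) * K.map (fun a : ℂ => (MvPolynomial.C a : MvPolynomial σ ℂ))).det =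
          (1 + Matrix.diagonal (fun i => MvPolynomial.X (κ' i)) * K'.map (fun a : ℂ => (MvPolynomial.C a : MvPolynomial σ ℂ))).det)
    (b : ℕ) :
    ∀ (R : ℕ) {σ : Type} [Fintype σ] (K : Matrix (Fin R) (Fin R) ℂ) (κ : Fin R → σ),
      q ^ b * R ≤ Q →
      Fintype.card σ ≤ n →
      (1 + Matrix.diagonal (fun i => MvPolynomial.X (κ i)) * K.map (fun a : ℂ => (MvPolynomial.C a : MvPolynomial σ ℂ))).det.totalDegree ≤ n →
      ‖Matrix.toEuclideanCLM (𝕜 := ℂ) K‖ ≤ (2 : ℝ) ^ b →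
      (∀ z : σ → ℂ, (∀ j, ‖z j‖ ≤ 2) → MvPolynomial.eval z (1 + Matrix.diagonal (fun i => MvPolynomial.X (κ i)) * K.map (fun a : ℂ => (MvPolynomial.C a : MvPolynomial σ ℂ))).det ≠ 0) →
      ∃ R' ≤ q ^ b * R, ∃ (K' : Matrix (Fin R') (Fin R') ℂ) (κ' : Fin R' → σ),
        ‖Matrix.toEuclideanCLM (𝕜 := ℂ) K'‖ ≤ 1 ∧
        (1 + Matrix.diagonal (fun i => MvPolynomial.X (κ i)) * K.map (fun a : ℂ => (MvPolynomial.C a : MvPolynomial σ ℂ))).det =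
          (1 + Matrix.diagonal (fun i => MvPolynomial.X (κ' i)) * K'.map (fun a : ℂ => (MvPolynomial.C a : MvPolynomial σ ℂ))).det := by
  induction b with
  | zero =>
    intro R σ _ K κ _hRQ _hσ _hdeg hK _hz
    exact ⟨R, by simp, K, κ, by simpa using hK, rfl⟩
  | succ b ih =>
    intro R σ _ K κ hRQ hσ hdeg hK hz
    have hM : (1 : ℝ) ≤ 2 ^ b := one_le_pow₀ (by norm_num)
    have hK2 : ‖Matrix.toEuclideanCLM (𝕜 := ℂ) K‖ ≤ 2 * 2 ^ b := by rw [pow_succ] at hK; linarith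
    -- the current size is in the domain: `R ≤ q ^ (b+1) · R ≤ Q`
    have hR : R ≤ Q :=
      le_trans (Nat.le_mul_of_pos_left R (Nat.pos_of_ne_zero (pow_ne_zero _ (by omega)))) hRQ
    obtain ⟨R₁, hR₁, K₁, κ₁, hK₁, h₁⟩ := hc R (2 ^ b) K κ hR hσ hdeg hM hK2 hz
    -- the invariant for the induction hypothesis: `q ^ b · R₁ ≤ q ^ (b+1) · R ≤ Q`
    have hqR : q ^ b * R₁ ≤ q ^ (b + 1) * R :=
      calc q ^ b * R₁ ≤ q ^ b * (q * R) := Nat.mul_le_mul_left _ hR₁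
        _ = q ^ (b + 1) * R := by rw [pow_succ, mul_assoc]
    have hdeg₁ : (1 + Matrix.diagonal (fun i => MvPolynomial.X (κ₁ i)) * K₁.map (fun a : ℂ => (MvPolynomial.C a : MvPolynomial σ ℂ))).det.totalDegree ≤ n := by
      rw [← h₁]; exact hdeg
    have hz₁ : (∀ z : σ → ℂ, (∀ j, ‖z j‖ ≤ 2) → MvPolynomial.eval z (1 + Matrix.diagonal (fun i => MvPolynomial.X (κ₁ i)) * K₁.map (fun a : ℂ => (MvPolynomial.C a : MvPolynomial σ ℂ))).det ≠ 0) := by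
      intro z hz'; rw [← h₁]; exact hz z hz'
    obtain ⟨R', hR', K', κ', hK', h'⟩ := ih R₁ K₁ κ₁ (hqR.trans hRQ) hσ hdeg₁ hK₁ hz₁
    exact ⟨R', hR'.trans hqR, K', κ', hK', h₁.trans h'⟩

/-- The exponent arithmetic of the composition: with `L = 2ℓ + 2`, `B = (L + d) ^ d` and
per-halving factor `2 ^ ((B + L + c) ^ c)`, the final size `(2 ^ ((B + L + c) ^ c)) ^ B · R₁`,
`R₁ ≤ 2 ^ B`, is `≤ 2 ^ ((ℓ + d') ^ d')` for `d' = 3d + 4c + 2dc + 4`. (Copied from the skeleton, §5.) -/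
theorem exponent_bound₂ (c d ℓ R₁ : ℕ) (hR : R₁ ≤ 2 ^ ((2 * ℓ + 2 + d) ^ d)) :
    (2 ^ (((2 * ℓ + 2 + d) ^ d + (2 * ℓ + 2) + c) ^ c)) ^ ((2 * ℓ + 2 + d) ^ d) * R₁ ≤
      2 ^ ((ℓ + (3 * d + 4 * c + 2 * (d * c) + 4)) ^ (3 * d + 4 * c + 2 * (d * c) + 4)) := by
  -- abbreviations
  generalize hB : (2 * ℓ + 2 + d) ^ d = B at *
  generalize hX : (B + (2 * ℓ + 2) + c) ^ c = X
  generalize hE : 3 * d + 4 * c + 2 * (d * c) + 4 = E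
  have h1 : (2 ^ X) ^ B * R₁ ≤ 2 ^ (X * B + B) := by
    rw [pow_add, ← pow_mul]; exact Nat.mul_le_mul_left _ hR
  refine h1.trans (Nat.pow_le_pow_right two_pos ?_)
  -- the exponent: `X * B + B ≤ (ℓ + E) ^ E` via `v := ℓ + 2 + d + c ≥ 2`
  obtain ⟨v, hv⟩ : ∃ v : ℕ, v = ℓ + 2 + d + c := ⟨_, rfl⟩
  have hv2 : 2 ≤ v := by omega
  have h2v : 1 ≤ 2 * v := by omega
  have hBle : B ≤ (2 * v) ^ d := by rw [← hB]; exact Nat.pow_le_pow_left (by omega) _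
  have hsum : B + (2 * ℓ + 2) + c ≤ (2 * v) ^ (d + 2) := by
    have ha : (2 * v) ^ d ≤ (2 * v) ^ (d + 1) := Nat.pow_le_pow_right h2v (by omega)
    have hb : 2 * v ≤ (2 * v) ^ (d + 1) := by
      calc 2 * v = (2 * v) ^ 1 := (pow_one _).symm
        _ ≤ (2 * v) ^ (d + 1) := Nat.pow_le_pow_right h2v (by omega)
    calc B + (2 * ℓ + 2) + c ≤ (2 * v) ^ d + 2 * v := by omega
      _ ≤ (2 * v) ^ (d + 1) + (2 * v) ^ (d + 1) := Nat.add_le_add ha hb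
      _ = 2 * (2 * v) ^ (d + 1) := (two_mul _).symm
      _ ≤ (2 * v) * (2 * v) ^ (d + 1) := Nat.mul_le_mul_right _ (by omega)
      _ = (2 * v) ^ (d + 2) := by rw [← pow_succ']
  have hXle : X ≤ (2 * v) ^ ((d + 2) * c) := by rw [← hX, pow_mul]; exact Nat.pow_le_pow_left hsum _
  have h3 : X * B + B ≤ (2 * v) ^ (d + (d + 2) * c + 1) := by
    have hX1 : X + 1 ≤ 2 * (2 * v) ^ ((d + 2) * c) := by
      have : 1 ≤ (2 * v) ^ ((d + 2) * c) := Nat.one_le_pow _ _ (by omega)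
      omega
    calc X * B + B = B * (X + 1) := by ring
      _ ≤ (2 * v) ^ d * (2 * (2 * v) ^ ((d + 2) * c)) := Nat.mul_le_mul hBle hX1
      _ = 2 * (2 * v) ^ (d + (d + 2) * c) := by rw [pow_add]; ring
      _ ≤ (2 * v) * (2 * v) ^ (d + (d + 2) * c) := Nat.mul_le_mul_right _ (by omega)
      _ = (2 * v) ^ (d + (d + 2) * c + 1) := by rw [← pow_succ']
  have h4 : (2 * v) ^ (d + (d + 2) * c + 1) ≤ (v * v) ^ (d + (d + 2) * c + 1) :=
    Nat.pow_le_pow_left (Nat.mul_le_mul_right v hv2) _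
  have h5 : (v * v) ^ (d + (d + 2) * c + 1) = v ^ (2 * (d + (d + 2) * c + 1)) := by
    rw [pow_mul, pow_two]
  have hE1 : 2 * (d + (d + 2) * c + 1) ≤ E := by
    rw [← hE]; nlinarith [Nat.zero_le d, Nat.zero_le c]
  have hE2 : v ≤ ℓ + E := by
    rw [← hE, hv]; nlinarith [Nat.zero_le d, Nat.zero_le c]
  have hE3 : 1 ≤ ℓ + E := by omega
  calc X * B + B ≤ (2 * v) ^ (d + (d + 2) * c + 1) := h3
    _ ≤ (v * v) ^ (d + (d + 2) * c + 1) := h4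
    _ = v ^ (2 * (d + (d + 2) * c + 1)) := h5
    _ ≤ (ℓ + E) ^ (2 * (d + (d + 2) * c + 1)) := Nat.pow_le_pow_left hE2 _
    _ ≤ (ℓ + E) ^ E := Nat.pow_le_pow_right hE3 hE1

/-- The domain arithmetic of the composition: `B` halvings at factor `2 ^ ((B + L + c) ^ c)`
starting from size `R₁ ≤ 2 ^ B` stay inside the domain `2 ^ ((B + L + c + 2) ^ (c + 2))` of NH₁
(`B · u^c + B ≤ (u + 2)^(c + 2)` for `u = B + L + c ≥ B`). (Copied from the skeleton, §5.) -/
theorem domain_bound (c B L R₁ : ℕ) (hR : R₁ ≤ 2 ^ B) :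
    (2 ^ ((B + L + c) ^ c)) ^ B * R₁ ≤ 2 ^ ((B + L + c + 2) ^ (c + 2)) := by
  generalize hu : B + L + c = u
  have hBu : B ≤ u := by omega
  have h1 : (2 ^ (u ^ c)) ^ B * R₁ ≤ 2 ^ (u ^ c * B + B) := by
    rw [pow_add, ← pow_mul]; exact Nat.mul_le_mul_left _ hR
  refine h1.trans (Nat.pow_le_pow_right two_pos ?_)
  rcases Nat.eq_zero_or_pos u with h0 | hpos
  · have hB0 : B = 0 := by omega
    simp [hB0]
  · have h2 : u ^ c * B ≤ u ^ (c + 1) := by rw [pow_succ]; exact Nat.mul_le_mul_left _ hBu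
    have h3 : B ≤ u ^ (c + 1) :=
      hBu.trans (calc u = u ^ 1 := (pow_one u).symm
        _ ≤ u ^ (c + 1) := Nat.pow_le_pow_right hpos (by omega))
    calc u ^ c * B + B ≤ u ^ (c + 1) + u ^ (c + 1) := Nat.add_le_add h2 h3
      _ = 2 * u ^ (c + 1) := (two_mul _).symm
      _ ≤ (u + 2) * u ^ (c + 1) := Nat.mul_le_mul_right _ (by omega)
      _ ≤ (u + 2) * (u + 2) ^ (c + 1) := Nat.mul_le_mul_left _ (Nat.pow_le_pow_left (by omega) _)
      _ = (u + 2) ^ (c + 2) := (pow_succ' _ _).symm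

/-! ### §4 The registered stub -/

/-- **Conditional partial case of the crux: `N ≤ 2 log₂(m+N) + 3` variables, from NH₁ alone.**
The first hypothesis is the norm-halving stub NH₁ verbatim (one norm scale `‖K‖ ≤ 2 ⟹ ‖K'‖ ≤ 1`,
size factor `2 ^ ((log₂ n + c) ^ c)`, domain `R ≤ 2 ^ ((log₂ n + c + 2) ^ (c + 2))`); the conclusion
is `PriceOfContractivity` with the extra hypothesis `N ≤ 2 * Nat.log 2 (m + N) + 3`.  Proof: normal
form (`R ≤ N·m ≤ 2 ^ L`, `L = 2 log₂(m+N) + 2`; `≤ #σ ≤ N ≤ L + 1` colours), balanced budget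
(`R₁, ‖K₁‖ ≤ 2 ^ B`, `B = (L + d) ^ d`), `B` halvings at `n = 2 ^ (B + L)` (a bound on `#σ` and on
the degree; the domain is never left: `domain_bound`), and `exponent_bound₂`. (Skeleton §6, adapted.) -/
theorem stub_priceOfContractivity_fewVars :
    (∃ c : ℕ, ∀ (n R : ℕ) {σ : Type} [Fintype σ] (K : Matrix (Fin R) (Fin R) ℂ) (κ : Fin R → σ),
      R ≤ 2 ^ ((Nat.log 2 n + c + 2) ^ (c + 2)) →
      Fintype.card σ ≤ n →
      (1 + Matrix.diagonal (fun i => MvPolynomial.X (κ i)) * K.map (fun a : ℂ => (MvPolynomial.C a : MvPolynomial σ ℂ))).det.totalDegree ≤ n →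
      ‖Matrix.toEuclideanCLM (𝕜 := ℂ) K‖ ≤ 2 →
      (∀ z : σ → ℂ, (∀ j, ‖z j‖ ≤ 2) → MvPolynomial.eval z (1 + Matrix.diagonal (fun i => MvPolynomial.X (κ i)) * K.map (fun a : ℂ => (MvPolynomial.C a : MvPolynomial σ ℂ))).det ≠ 0) →
      ∃ R' ≤ 2 ^ ((Nat.log 2 n + c) ^ c) * R, ∃ (K' : Matrix (Fin R') (Fin R') ℂ) (κ' : Fin R' → σ),
        ‖Matrix.toEuclideanCLM (𝕜 := ℂ) K'‖ ≤ 1 ∧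
        (1 + Matrix.diagonal (fun i => MvPolynomial.X (κ i)) * K.map (fun a : ℂ => (MvPolynomial.C a : MvPolynomial σ ℂ))).det =
          (1 + Matrix.diagonal (fun i => MvPolynomial.X (κ' i)) * K'.map (fun a : ℂ => (MvPolynomial.C a : MvPolynomial σ ℂ))).det) →
    ∃ d : ℕ, ∀ (N m : ℕ) {σ : Type} [Fintype σ] (p : MvPolynomial σ ℂ), Fintype.card σ ≤ N →
      N ≤ 2 * Nat.log 2 (m + N) + 3 →
      Literature.Computability.AlgebraicComplexity.HasDetRepr p m →
      (∀ z : σ → ℂ, (∀ j, ‖z j‖ ≤ 2) → MvPolynomial.eval z p ≠ 0) →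
      ∃ R ≤ 2 ^ ((Nat.log 2 (m + N) + d) ^ d), ∃ (K : Matrix (Fin R) (Fin R) ℂ) (κ : Fin R → σ),
        ‖Matrix.toEuclideanCLM (𝕜 := ℂ) K‖ ≤ 1 ∧
        p = MvPolynomial.C (MvPolynomial.eval 0 p) *
          (1 + Matrix.diagonal (fun i => MvPolynomial.X (κ i)) * K.map (fun a : ℂ => (MvPolynomial.C a : MvPolynomial σ ℂ))).det := by
  intro h1
  -- NH₁ ⟹ NH at every scale `M ≥ 1` (the landed rescaling glue)
  obtain ⟨c, hc⟩ := NormHalvingRescale.stub_normHalvingRescale h1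
  -- the balanced budget for at most `L + 1` colours (Theorem A″ + cycle-mean bound + balancing)
  obtain ⟨d, hd⟩ := balancedBudget_fewColours
  refine ⟨3 * d + 4 * c + 2 * (d * c) + 4, ?_⟩
  intro N m σ _ p hσ hN hrep hzero
  -- `p(0) ≠ 0` (zero-freeness at the centre)
  have hp0 : MvPolynomial.eval 0 p ≠ 0 :=
    hzero 0 (fun j => by simp only [Pi.zero_apply, norm_zero]; norm_num)
  -- Sylvester normal form
  obtain ⟨R, hR, K₀, κ, hnf⟩ := normalForm_of_hasDetRepr hrep hp0
  -- the pencil inherits zero-freeness on the closed radius-2 polydisc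
  have hz₀ : (∀ z : σ → ℂ, (∀ j, ‖z j‖ ≤ 2) → MvPolynomial.eval z (1 + Matrix.diagonal (fun i => MvPolynomial.X (κ i)) * K₀.map (fun a : ℂ => (MvPolynomial.C a : MvPolynomial σ ℂ))).det ≠ 0) :=
    fun z hz h => hzero z hz (by rw [hnf, map_mul, h, mul_zero])
  -- bit length of the size: `R ≤ N·m ≤ (m+N)² ≤ 2 ^ L`, `L = 2 log₂(m+N) + 2`
  have hlog : m + N < 2 ^ (Nat.log 2 (m + N) + 1) := Nat.lt_pow_succ_log_self one_lt_two _
  have hRL : R ≤ 2 ^ (2 * Nat.log 2 (m + N) + 2) := by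
    calc R ≤ Fintype.card σ * m := hR
      _ ≤ (m + N) * (m + N) :=
          Nat.mul_le_mul (hσ.trans (Nat.le_add_left N m)) (Nat.le_add_right m N)
      _ ≤ 2 ^ (Nat.log 2 (m + N) + 1) * 2 ^ (Nat.log 2 (m + N) + 1) := Nat.mul_le_mul hlog.le hlog.le
      _ = 2 ^ (2 * Nat.log 2 (m + N) + 2) := by rw [← pow_add]; ring_nf
  -- the normal-form colouring uses at most `#σ ≤ N ≤ L + 1` colours
  have hcol : ∃ s : Finset σ, s.card ≤ 2 * Nat.log 2 (m + N) + 2 + 1 ∧ ∀ i, κ i ∈ s :=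
    ⟨Finset.univ, by rw [Finset.card_univ]; omega, fun i => Finset.mem_univ _⟩
  -- balanced budget
  obtain ⟨R₁, hR₁, K₁, κ₁, hK₁, hdet₁⟩ := hd (2 * Nat.log 2 (m + N) + 2) R K₀ κ hcol hRL hz₀
  have hz₁ : (∀ z : σ → ℂ, (∀ j, ‖z j‖ ≤ 2) → MvPolynomial.eval z (1 + Matrix.diagonal (fun i => MvPolynomial.X (κ₁ i)) * K₁.map (fun a : ℂ => (MvPolynomial.C a : MvPolynomial σ ℂ))).det ≠ 0) := by
    intro z hz; rw [← hdet₁]; exact hz₀ z hz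
  -- the complexity bound `n = 2 ^ (B + L)` for the halving step
  generalize hL : 2 * Nat.log 2 (m + N) + 2 = L at *
  generalize hB : (L + d) ^ d = B at *
  have hcard : Fintype.card σ ≤ 2 ^ (B + L) := hσ.trans ((Nat.le_add_left N m).trans
    (hlog.le.trans (Nat.pow_le_pow_right two_pos (by omega))))
  have hdeg : (1 + Matrix.diagonal (fun i => MvPolynomial.X (κ₁ i)) * K₁.map (fun a : ℂ => (MvPolynomial.C a : MvPolynomial σ ℂ))).det.totalDegree ≤ 2 ^ (B + L) :=
    (StableLifting.totalDegree_pencil_det_le K₁ κ₁).trans ((Fintype.card_fin R₁).le.trans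
      (hR₁.trans (Nat.pow_le_pow_right two_pos (by omega))))
  -- the iteration stays in the domain of the halving step
  have hdom : (2 ^ ((Nat.log 2 (2 ^ (B + L)) + c) ^ c)) ^ B * R₁ ≤
      2 ^ ((Nat.log 2 (2 ^ (B + L)) + c + 2) ^ (c + 2)) := by
    rw [Nat.log_pow one_lt_two]
    exact domain_bound c B L R₁ hR₁
  -- `B` halvings down to a contraction
  obtain ⟨R', hR', K', κ', hK', hdet'⟩ :=
    priceInBudget_of_normHalvingDom (q := 2 ^ ((Nat.log 2 (2 ^ (B + L)) + c) ^ c))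
      (Q := 2 ^ ((Nat.log 2 (2 ^ (B + L)) + c + 2) ^ (c + 2))) (n := 2 ^ (B + L))
      Nat.one_le_two_pow (fun R M σ _ K κ => hc (2 ^ (B + L)) R M K κ) B R₁ K₁ κ₁ hdom hcard hdeg
      hK₁ hz₁
  refine ⟨R', ?_, K', κ', hK', hnf.trans (by rw [hdet₁, hdet'])⟩
  rw [Nat.log_pow one_lt_two] at hR'
  subst hL hB
  exact hR'.trans (exponent_bound₂ c d (Nat.log 2 (m + N)) R₁ hR₁)

end Summit.ValiantsHypothesis.ValiantsHypothesis.Theorems.PriceOfContractivity.FewVars
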